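import Mathlib
import Summits.Ventures.PercRepro2.SwOutCrossJunctionSwG

/-!
# Three connected dropped components at one junction (blind cell PercRepro2, night-4 g25,
2026-08-28; proofs/NIGHT4-G25.md §4)

The glued fibre `fibKEESum` has the `KE` fields, so the gluing iterates: the inequality of the
record of `(G₁ ⊕g G₂) ⊕g G₃` follows from that of `G₁ ⊕g G₂` (`ineqM_fibKEESum_of`: from ANY
first fibre with the `KE` fields and the inequality), hence `IneqAll` for three components
(`ineqAll_sum₃`) and **`sw_of_crossJunction₃`**: row (SW) on every graph with a junction whose
dropped vertices form three connected cross-edge components.  Each further component is one more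
application of `fibKEESum`.
-/

namespace Summit.Ventures.PercRepro2

namespace CrossArm

open Hull LocRows

universe uV

variable {V : Type uV} {E : Type*} [Fintype E] [DecidableEq E]

open scoped Classical

section Inst

variable {W A L : Type*} {ι : Type*} (F : FibreMin W A L) [Fintype ι] [DecidableEq ι]

/-- The inequality does not depend on the finiteness instance of the fibre (a subsingleton). -/
lemma IneqM.congr_inst (i₁ : Fintype W) [i₂ : Fintype W]
    (h : letI := i₁; IneqM F (ι := ι)) : IneqM F (ι := ι) := by
  obtain rfl : i₁ = i₂ := Subsingleton.elim _ _
  exact h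

end Inst

section Iterate

variable {X₁ X₂ : Type*} {G₁ : SimpleGraph X₁} (G₂ : SimpleGraph X₂)
  [Fintype X₁] [DecidableEq X₁] [DecidableRel G₁.Adj]
  [Fintype X₂] [DecidableEq X₂] [DecidableRel G₂.Adj] [Nonempty X₂] (hG₂ : G₂.Connected)
  (F₁ : FibreIter (FibKE X₁ G₁) (AtomKEE X₁ G₁) (LabelKE X₁))
  (hflip : F₁.flip = FibKE.flip) (hleak : F₁.leakR = leakKE G₁)
  (hlab : F₁.label = labelKE G₁) (hB : F₁.BetterL = BetterKE) (hred : F₁.red = redKEE G₁)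
  {ι : Type*} [Fintype ι] [DecidableEq ι] [Nonempty ι]

include hG₂ hflip hleak hlab hB hred in
/-- The record of a sum has the inequality whenever the first fibre (with the `KE` fields) has
it and the second component is connected. -/
theorem ineqM_fibKEESum_of (hineq : Ineq F₁ (ι := ι)) :
    IneqM (fibKEEMin (G₁ ⊕g G₂)) (ι := ι) :=
  ineqM_of_ineq (fibKEESum G₂ F₁ hflip hleak hlab hB hred)
    (ineq_fibKEESum G₂ hG₂ F₁ hflip hleak hlab hB hred hineq)

end Iterate

section Three

variable {X₁ X₂ X₃ : Type*} [Fintype X₁] [DecidableEq X₁] [Nonempty X₁]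
  [Fintype X₂] [DecidableEq X₂] [Nonempty X₂] [Fintype X₃] [DecidableEq X₃] [Nonempty X₃]
  {G₁ : SimpleGraph X₁} {G₂ : SimpleGraph X₂} {G₃ : SimpleGraph X₃}
  [DecidableRel G₁.Adj] [DecidableRel G₂.Adj] [DecidableRel G₃.Adj]
  (hG₁ : G₁.Connected) (hG₂ : G₂.Connected) (hG₃ : G₃.Connected)
  {ends : E → Sym2 V} {U : Set V} {l h o u : V} {p : (X₁ ⊕ X₂) ⊕ X₃ → V}
include hG₁ hG₂ hG₃

/-- The record of three connected components has the inequality over every u-arm type. -/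
theorem ineqAll_sum₃ : IneqAll ((G₁ ⊕g G₂) ⊕g G₃) V := by
  intro S _ _ _ _ _
  exact IneqM.congr_inst _ _ (ineqM_fibKEESum_of G₃ hG₃ (fibKEESum₂ G₁ G₂ hG₁) rfl rfl rfl rfl rfl
    (ineq_fibKEESum₂ G₁ G₂ hG₁ hG₂ (ι := {P // P ∈ S})))

/-- **THEOREM A_cross FOR THREE CONNECTED DROPPED COMPONENTS AT ONE JUNCTION**: the rigid
inequality on every class, for every outside colouring. -/
theorem CrossJunction.rigidOK_of_crossJunction₃
    (hj : CrossJunction ends U h u p ((G₁ ⊕g G₂) ⊕g G₃) o) (hl : l ∉ U) (ξ : Config E) :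
    RigidOK ends l h o U ξ :=
  hj.rigidOK_of_crossJunction' hl (ineqAll_sum₃ hG₁ hG₂ hG₃)

/-- **Row (SW) on every graph with a junction whose dropped vertices form three connected
cross-edge components.** -/
theorem sw_of_crossJunction₃ (hlh : l ≠ h)
    (hj : CrossJunction ends ({l}ᶜ) h u p ((G₁ ⊕g G₂) ⊕g G₃) o) : Sw ends l h o :=
  sw_of_crossJunction' hlh hj (ineqAll_sum₃ hG₁ hG₂ hG₃)

end Three

end CrossArm

end Summit.Ventures.PercRepro2
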